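import Literature.Computability.AlgebraicComplexity.MS2001KempfStabilityHolds
import Literature.Computability.AlgebraicComplexity.BI17DetPerMinimalDegreeProofs
import Mathlib.LinearAlgebra.Matrix.Permutation
import HarnessLib

/-!
# GCT I Thm. 7.3, the one-row corner: `E(X) = x₁⋯x_k` (`m = 1`) — and the Chow form `∏ xᵢ` in
# general — has a closed `SL`-orbit over every algebraically closed field

Mulmuley–Sohoni 2001 (GCT I), Thm. 7.3 (authors' version; journal Thm. 7.1): the form
`E(X) = ∏_{σ : [m] → [k]} det_σ(X)` (`msE F m k`) is stable — its `SL_{km²}`-orbit is Zariski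
closed (`IsPolystable`) — over an algebraically closed `F` (with characteristic provisos). The
typed fact `MS2001_thm_7_3` is being closed (cell `val-lit`, owner t02 g8) by Kempf's criterion,
now in the tree for `SL_σ` on forms over every algebraically closed field
(`MS2001KempfStabilityHolds.isPolystable_of_forall_submodule_sl`: if the `SL`-stabiliser of a form
acts irreducibly on `K^σ`, its orbit is closed), plus the irreducibility of the stabiliser of
`E(X)` for `m ≥ 2` (p5 g6). THIS FILE is the input brick for the corner `m = 1`, where
`E(X) = x₁ x₂ ⋯ x_k` is the CHOW FORM (`msE_one_eq_prod_X`) and the stabiliser is irreducible only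
for `k ≥ 3`:

* `forall_submodule_stable_prod_X` / `isPolystable_prod_X_of_three_le` (§1): for `|ι| ≥ 3` the
  `SL`-stabiliser of `∏ xᵢ` — containing the torus `diag(β)`, `∏ β = 1`, and the even permutation
  matrices — acts irreducibly on `K^ι` (a torus element `diag(θ, θ⁻¹, 1, …)` with `θ² ≠ 1` cuts a
  non-zero vector of a stable subspace down to an elementary vector; products of two
  transpositions move it everywhere), so Kempf's criterion gives a closed orbit; `|ι| ≤ 1` is
  vacuous (`isPolystable_prod_X_of_card_le_one`).
* `isPolystable_X_mul_X` (§2): `xy` (`|ι| = 2`, where `Stab_SL₂(xy)` is a torus and Kempf's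
  criterion is silent) by the ONE-PARAMETER-SUBGROUP CRITERION
  `HilbertMumfordSLForms.isPolystable_iff_forall_diagLimit_mem_slOrbit`: for `g ∈ SL₂` and weights
  `(s, −s)`, admissibility of `g·(xy) = αx² + βxy + γy²` kills `γ` (resp. `α`), `det g = 1` then
  forces `β = ±1`, and `±xy ∈ SL₂·xy` (`x ↦ ζy, y ↦ ζx`, `ζ² = −1`).
* `isPolystable_prod_X_of_isAlgClosed` (§3): **the Chow form `∏_{i ∈ ι} xᵢ` is polystable over every
  algebraically closed field, for every finite `ι`** (Bürgisser–Ikenmeyer 2017 Cor. 2.9 states it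
  over `ℂ`; the tree's `isPolystable_prod_X` is the `ℂ` instance via Kempf–Ness); and
  `isPolystable_msE_one : IsPolystable (msE K 1 k)` for every `k`, no characteristic proviso.

THEOREMS ONLY (no definitions, no named facts). Honest framing: elementary invariant theory in the
tree's currency; nothing here bears on `P` versus `NP` or `VP` versus `VNP`; `MS2001_thm_7_3`
itself is NOT discharged here (the `m ≥ 2` range and the closer are other seats'). Cell `val-lit`,
seat t14 g7 (programme #9 follow-up, RULINGS #71 (2)).

## References

* [MulmuleySohoniSIAM2001] K. Mulmuley, M. Sohoni, *GCT I*, SIAM J. Comput. 31 (2001), §7 (the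
  form `E(X)`, AV p.30), Thm. 7.3 (AV p.31) = journal Thm. 7.1.
* [BurgisserIkenmeyer2017] P. Bürgisser, C. Ikenmeyer, *Fundamental invariants of orbit closures*,
  J. Algebra 477 (2017), Def. 2.7, Cor. 2.9 (the forms `X₁⋯X_m`, …, are polystable).
* [Kempf1978] G. R. Kempf, *Instability in invariant theory*, Ann. of Math. 108 (1978), Thm. 1.4,
  Cor. 4.5.
-/

noncomputable section

open scoped BigOperators
open MvPolynomial

namespace Literature.Computability.AlgebraicComplexity

variable {K : Type} [Field K]

/-! ### §1. The Chow form `∏ xᵢ` and its obvious symmetries -/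

section Chow

variable {ι : Type} [Fintype ι] [DecidableEq ι]

omit [DecidableEq ι] in
/-- `∏ xᵢ` is the monomial `x^𝟙`. [cite: BurgisserIkenmeyer2017, Cor. 2.9 (the form `X₁⋯X_m`)] -/
theorem prod_X_univ_eq_monomial :
    (∏ i : ι, X i : MvPolynomial ι K) = monomial (∑ i : ι, Finsupp.single i 1) 1 := by
  rw [monomial_sum_index, C_1, one_mul]
  rfl

omit [DecidableEq ι] in
/-- `∏ xᵢ` is a form of degree `|ι|`. [cite: BurgisserIkenmeyer2017, Cor. 2.9 (the form `X₁⋯X_m`)] -/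
theorem isHomogeneous_prod_X_univ :
    (∏ i : ι, X i : MvPolynomial ι K).IsHomogeneous (Fintype.card ι) := by
  have h := IsHomogeneous.prod Finset.univ (fun i : ι => (X i : MvPolynomial ι K)) (fun _ => 1)
    (fun i _ => isHomogeneous_X K i)
  simpa using h

/-- The diagonal torus of `SL` fixes `∏ xᵢ`: `diag(β)·∏ xᵢ = (∏ βᵢ) ∏ xᵢ`.
[cite: BurgisserIkenmeyer2017, Cor. 2.9 (the form `X₁⋯X_m`)] -/
theorem linSubst_diagonal_prod_X (β : ι → K) :
    linSubst ι K (Matrix.diagonal β) (∏ i : ι, X i) = (∏ i, β i) • ∏ i : ι, X i := by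
  rw [prod_X_univ_eq_monomial, linSubst_diagonal_monomial']
  congr 1
  refine Finset.prod_congr rfl fun i _ => ?_
  rw [Finsupp.finsetSum_apply, Finset.sum_eq_single i (fun j _ hj => by
    rw [Finsupp.single_apply, if_neg hj]) (fun h => absurd (Finset.mem_univ i) h),
    Finsupp.single_eq_same, pow_one]

omit [Fintype ι] in
/-- Entries of a permutation matrix. [folklore] -/
private theorem permMatrix_apply' (π : Equiv.Perm ι) (j i : ι) :
    (π.permMatrix K) j i = if i = π j then (1 : K) else 0 := by
  rw [Equiv.Perm.permMatrix, PEquiv.toMatrix_toPEquiv_apply, Pi.single_apply]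

/-- A permutation matrix sends `xᵢ` to `x_{π⁻¹ i}`. [folklore] -/
private theorem linSubst_permMatrix_X (π : Equiv.Perm ι) (i : ι) :
    linSubst ι K (π.permMatrix K) (X i) = X (π.symm i) := by
  rw [linSubst_X, Finset.sum_eq_single (π.symm i)]
  · rw [permMatrix_apply', if_pos (Equiv.apply_symm_apply π i).symm, one_smul]
  · intro j _ hj
    rw [permMatrix_apply', if_neg, zero_smul]
    intro h
    apply hj
    rw [h, Equiv.symm_apply_apply]
  · intro h
    exact absurd (Finset.mem_univ _) h

/-- Permutation matrices fix `∏ xᵢ`. [cite: BurgisserIkenmeyer2017, Cor. 2.9 (the form `X₁⋯X_m`)] -/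
theorem linSubst_permMatrix_prod_X (π : Equiv.Perm ι) :
    linSubst ι K (π.permMatrix K) (∏ i : ι, X i) = ∏ i : ι, X i := by
  rw [map_prod]
  simp_rw [linSubst_permMatrix_X]
  exact Equiv.prod_comp π.symm (fun i => (X i : MvPolynomial ι K))

/-- A permutation matrix moves elementary vectors: `P_π e_{i} = e_{π⁻¹ i}`. [folklore] -/
private theorem permMatrix_mulVec_single (π : Equiv.Perm ι) (i : ι) :
    (π.permMatrix K).mulVec (Pi.single i 1) = Pi.single (π.symm i) 1 := by
  funext j
  rw [Matrix.mulVec, dotProduct, Finset.sum_eq_single i]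
  · rw [Pi.single_eq_same, mul_one, permMatrix_apply', Pi.single_apply]
    by_cases h : j = π.symm i
    · rw [if_pos h, if_pos]; rw [h, Equiv.apply_symm_apply]
    · rw [if_neg h, if_neg]; intro h'; apply h; rw [h', Equiv.symm_apply_apply]
  · intro l _ hl
    rw [Pi.single_apply, if_neg hl, mul_zero]
  · intro h
    exact absurd (Finset.mem_univ _) h

/-- **The `SL`-stabiliser of `∏ xᵢ` acts irreducibly on `K^ι` when `|ι| ≥ 3`** (`K` infinite): a
non-zero stable subspace contains an elementary vector (cut a non-zero vector down with the torus
element `diag(θ, θ⁻¹, 1, …)`, `θ² ≠ 1`), then all of them (even permutations — products of two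
transpositions — are in the stabiliser and act transitively), hence is everything. For `|ι| = 2`
this fails (`Stab_SL(xy)` is the torus). [cite: Kempf1978, Cor. 4.5] [cite: BurgisserIkenmeyer2017, Cor. 2.9 (the form `X₁⋯X_m`)] -/
theorem forall_submodule_stable_prod_X [Infinite K] (hι : 3 ≤ Fintype.card ι) (W : Submodule K (ι → K))
    (hW : ∀ γ : Matrix.SpecialLinearGroup ι K,
      linSubst ι K (γ : Matrix ι ι K) (∏ i : ι, X i) = ∏ i : ι, X i →
        ∀ x ∈ W, (γ : Matrix ι ι K).mulVec x ∈ W) :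
    W = ⊥ ∨ W = ⊤ := by
  classical
  rcases eq_or_ne W ⊥ with h | h
  · exact Or.inl h
  right
  obtain ⟨w, hw, hw0⟩ := (Submodule.ne_bot_iff W).mp h
  obtain ⟨i₀, hi₀⟩ := Function.ne_iff.mp hw0
  rw [Pi.zero_apply] at hi₀
  obtain ⟨i₁, hi₁⟩ := Fintype.exists_ne_of_one_lt_card (by omega) i₀
  -- a scalar `θ ∉ {0, 1, -1}`
  obtain ⟨θ, hθ⟩ := Infinite.exists_notMem_finset ({0, 1, -1} : Finset K)
  simp only [Finset.mem_insert, Finset.mem_singleton, not_or] at hθ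
  obtain ⟨hθ0, hθ1, hθm1⟩ := hθ
  have hθsq : θ - θ⁻¹ ≠ 0 := by
    intro h0
    have h1 : θ * θ = 1 := by
      have := sub_eq_zero.mp h0
      field_simp at this
      linear_combination this
    rcases mul_self_eq_one_iff.mp h1 with h2 | h2
    · exact hθ1 h2
    · exact hθm1 h2
  -- the torus element `T = diag(β)`, `β = (θ at i₀, θ⁻¹ at i₁, 1 elsewhere)`
  set β : ι → K := fun i => (if i = i₀ then θ else 1) * (if i = i₁ then θ⁻¹ else 1) with hβ
  have hβprod : ∏ i, β i = 1 := by
    rw [hβ, Finset.prod_mul_distrib, Finset.prod_ite_eq', Finset.prod_ite_eq', if_pos (Finset.mem_univ _),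
      if_pos (Finset.mem_univ _), mul_inv_cancel₀ hθ0]
  have hβ₀ : β i₀ = θ := by simp [hβ, hi₁.symm]
  have hβ₁ : β i₁ = θ⁻¹ := by simp [hβ, hi₁]
  have hβe : ∀ i, i ≠ i₀ → i ≠ i₁ → β i = 1 := fun i h0 h1 => by simp [hβ, h0, h1]
  let T : Matrix.SpecialLinearGroup ι K :=
    ⟨Matrix.diagonal β, by rw [Matrix.det_diagonal, hβprod]⟩
  have hTfix : linSubst ι K (T : Matrix ι ι K) (∏ i : ι, X i) = ∏ i : ι, X i := by
    change linSubst ι K (Matrix.diagonal β) _ = _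
    rw [linSubst_diagonal_prod_X, hβprod, one_smul]
  have hTmul : ∀ x : ι → K, (T : Matrix ι ι K).mulVec x = fun i => β i * x i := fun x => by
    funext i
    exact Matrix.mulVec_diagonal β x i
  -- cut `w` down to `e_{i₀}`
  have hy : (fun i => β i * w i) - w ∈ W := by
    have := hW T hTfix w hw
    rw [hTmul] at this
    exact W.sub_mem this hw
  have hz : (fun i => β i * (β i * w i - w i)) - θ⁻¹ • ((fun i => β i * w i) - w) ∈ W := by
    have := hW T hTfix _ hy
    rw [hTmul] at this
    exact W.sub_mem this (W.smul_mem _ hy)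
  have hzeq : (fun i => β i * (β i * w i - w i)) - θ⁻¹ • ((fun i => β i * w i) - w) =
      ((θ - θ⁻¹) * (θ - 1) * w i₀) • (Pi.single i₀ 1 : ι → K) := by
    funext i
    simp only [Pi.sub_apply, Pi.smul_apply, smul_eq_mul, Pi.single_apply]
    by_cases h0 : i = i₀
    · rw [h0, hβ₀, if_pos rfl]; ring
    · rw [if_neg h0]
      by_cases h1 : i = i₁
      · rw [h1, hβ₁]; ring
      · rw [hβe i h0 h1]; ring
  have hc : (θ - θ⁻¹) * (θ - 1) * w i₀ ≠ 0 :=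
    mul_ne_zero (mul_ne_zero hθsq (sub_ne_zero.mpr hθ1)) hi₀
  have he₀ : (Pi.single i₀ 1 : ι → K) ∈ W := by
    have := W.smul_mem ((θ - θ⁻¹) * (θ - 1) * w i₀)⁻¹ (hzeq ▸ hz)
    rwa [smul_smul, inv_mul_cancel₀ hc, one_smul] at this
  -- move `e_{i₀}` to every `e_j` with an even permutation
  have hall : ∀ j, (Pi.single j 1 : ι → K) ∈ W := by
    intro j
    by_cases hj : j = i₀
    · rw [hj]; exact he₀
    have hlt : ({i₀, j} : Finset ι).card < (Finset.univ : Finset ι).card := by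
      rw [Finset.card_pair (Ne.symm hj), Finset.card_univ]
      omega
    obtain ⟨l, -, hl⟩ := Finset.exists_mem_notMem_of_card_lt_card hlt
    simp only [Finset.mem_insert, Finset.mem_singleton, not_or] at hl
    obtain ⟨hl0, hlj⟩ := hl
    set π : Equiv.Perm ι := Equiv.swap j l * Equiv.swap j i₀ with hπ
    have hπj : π j = i₀ := by
      rw [hπ, Equiv.Perm.mul_apply, Equiv.swap_apply_left,
        Equiv.swap_apply_of_ne_of_ne (Ne.symm hj) (Ne.symm hl0)]
    have hsign : Equiv.Perm.sign π = 1 := by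
      rw [hπ, map_mul, Equiv.Perm.sign_swap (Ne.symm hlj), Equiv.Perm.sign_swap hj]
      decide
    let P : Matrix.SpecialLinearGroup ι K :=
      ⟨π.permMatrix K, by rw [Matrix.det_permutation, hsign, Units.val_one, Int.cast_one]⟩
    have hPfix : linSubst ι K (P : Matrix ι ι K) (∏ i : ι, X i) = ∏ i : ι, X i :=
      linSubst_permMatrix_prod_X π
    have := hW P hPfix _ he₀
    change (π.permMatrix K).mulVec (Pi.single i₀ 1) ∈ W at this
    rw [permMatrix_mulVec_single] at this
    have hπs : π.symm i₀ = j := by rw [← hπj, Equiv.symm_apply_apply]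
    rwa [hπs] at this
  refine Submodule.eq_top_iff'.mpr fun v => ?_
  rw [pi_eq_sum_univ' v]
  exact W.sum_mem fun x _ => W.smul_mem _ (hall x)

/-- **The Chow form `∏ xᵢ` has a closed `SL`-orbit for `|ι| ≥ 3`** over every algebraically closed
field (Kempf's criterion `isPolystable_of_forall_submodule_sl` + the irreducibility above).
[cite: BurgisserIkenmeyer2017, Cor. 2.9 (the form `X₁⋯X_m`)] [cite: Kempf1978, Cor. 4.5] -/
theorem isPolystable_prod_X_of_three_le [IsAlgClosed K] (hι : 3 ≤ Fintype.card ι) :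
    IsPolystable (∏ i : ι, X i : MvPolynomial ι K) :=
  isPolystable_of_forall_submodule_sl isHomogeneous_prod_X_univ (forall_submodule_stable_prod_X hι)

/-- For `|ι| ≤ 1` every subspace of `K^ι` is `⊥` or `⊤`, so Kempf's criterion applies vacuously.
[cite: Kempf1978, Cor. 4.5] -/
theorem isPolystable_prod_X_of_card_le_one [IsAlgClosed K] (hι : Fintype.card ι ≤ 1) :
    IsPolystable (∏ i : ι, X i : MvPolynomial ι K) := by
  refine isPolystable_of_forall_submodule_sl isHomogeneous_prod_X_univ fun W _ => ?_
  rcases eq_or_ne W ⊥ with h | h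
  · exact Or.inl h
  right
  obtain ⟨w, hw, hw0⟩ := (Submodule.ne_bot_iff W).mp h
  obtain ⟨i₀, hi₀⟩ := Function.ne_iff.mp hw0
  rw [Pi.zero_apply] at hi₀
  have hsub : ∀ i : ι, i = i₀ := fun i =>
    Fintype.card_le_one_iff.mp hι i i₀
  refine Submodule.eq_top_iff'.mpr fun v => ?_
  have hv : v = (v i₀ * (w i₀)⁻¹) • w := by
    funext i
    rw [hsub i, Pi.smul_apply, smul_eq_mul, inv_mul_cancel_right₀ hi₀]
  rw [hv]
  exact W.smul_mem _ hw

end Chow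

/-! ### §2. Two variables: `xy` has a closed `SL₂`-orbit (the one-parameter-subgroup criterion) -/

section Two

/-- `g·x_i = g_{0i} x_0 + g_{1i} x_1` on `Fin 2`. [folklore] -/
private theorem linSubst_X_fin_two (g : Matrix (Fin 2) (Fin 2) K) (i : Fin 2) :
    linSubst (Fin 2) K g (X i) = C (g 0 i) * X 0 + C (g 1 i) * X 1 := by
  rw [linSubst_X, Fin.sum_univ_two, smul_eq_C_mul, smul_eq_C_mul]

/-- The binary quadratic `g·(xy)` written out in monomials. [folklore] -/
private theorem linSubst_X_mul_X (g : Matrix (Fin 2) (Fin 2) K) :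
    linSubst (Fin 2) K g (X 0 * X 1) =
      monomial (Finsupp.single 0 2) (g 0 0 * g 0 1) +
        (monomial (Finsupp.single 0 1 + Finsupp.single 1 1) (g 0 0 * g 1 1 + g 1 0 * g 0 1) +
        monomial (Finsupp.single 1 2) (g 1 0 * g 1 1)) := by
  rw [map_mul, linSubst_X_fin_two, linSubst_X_fin_two]
  have h0 : (X 0 : MvPolynomial (Fin 2) K) = monomial (Finsupp.single 0 1) 1 := rfl
  have h1 : (X 1 : MvPolynomial (Fin 2) K) = monomial (Finsupp.single 1 1) 1 := rfl
  rw [h0, h1]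
  simp only [C_mul_monomial, mul_add, add_mul, monomial_mul]
  rw [show Finsupp.single (0 : Fin 2) 1 + Finsupp.single 0 1 = Finsupp.single 0 2 by
      rw [← Finsupp.single_add],
    show Finsupp.single (1 : Fin 2) 1 + Finsupp.single 1 1 = Finsupp.single 1 2 by
      rw [← Finsupp.single_add],
    show Finsupp.single (1 : Fin 2) 1 + Finsupp.single 0 1 = Finsupp.single 0 1 + Finsupp.single 1 1
      from add_comm _ _]
  simp only [mul_one, map_add]
  ring

/-- `diagLimit` of a monomial. [cite: Kempf1978, §1 (`lim_{t→0} λ(t)x`)] -/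
private theorem diagLimit_monomial' {σ : Type} [Fintype σ] [DecidableEq σ] (a : σ → ℤ) (d : σ →₀ ℕ)
    (c : K) : diagLimit a (monomial d c) = if diagWeight a d = 0 then monomial d c else 0 := by
  classical
  ext e
  rw [coeff_diagLimit, coeff_monomial]
  by_cases hde : d = e
  · subst hde
    by_cases hw : diagWeight a d = 0
    · rw [if_pos hw, if_pos rfl, if_pos hw, coeff_monomial, if_pos rfl]
    · rw [if_neg hw, if_neg hw, coeff_zero]
  · rw [if_neg hde, ite_self]
    by_cases hw : diagWeight a d = 0
    · rw [if_pos hw, coeff_monomial, if_neg hde]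
    · rw [if_neg hw, coeff_zero]

/-- `diagLimit` is additive. [cite: Kempf1978, §1 (`lim_{t→0} λ(t)x`)] -/
private theorem diagLimit_add' {σ : Type} [Fintype σ] [DecidableEq σ] (a : σ → ℤ)
    (p q : MvPolynomial σ K) : diagLimit a (p + q) = diagLimit a p + diagLimit a q := by
  ext e
  simp only [coeff_diagLimit, coeff_add]
  split_ifs <;> simp

/-- `xy` as a monomial. [folklore] -/
private theorem X_mul_X_eq_monomial :
    (X 0 * X 1 : MvPolynomial (Fin 2) K) = monomial (Finsupp.single 0 1 + Finsupp.single 1 1) 1 := by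
  have h0 : (X 0 : MvPolynomial (Fin 2) K) = monomial (Finsupp.single 0 1) 1 := rfl
  have h1 : (X 1 : MvPolynomial (Fin 2) K) = monomial (Finsupp.single 1 1) 1 := rfl
  rw [h0, h1, monomial_mul, mul_one]

/-- `-xy ∈ SL₂·(xy)` over an algebraically closed field (`x ↦ ζy`, `y ↦ ζx`, `ζ² = -1`).
[cite: BurgisserIkenmeyer2017, Cor. 2.9 (the form `X₁⋯X_m`)] -/
private theorem neg_X_mul_X_mem_slOrbit [IsAlgClosed K] :
    -(X 0 * X 1 : MvPolynomial (Fin 2) K) ∈ slOrbit (Fin 2) K (X 0 * X 1) := by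
  obtain ⟨ζ, hζ⟩ := IsAlgClosed.exists_pow_nat_eq (-1 : K) (n := 2) two_pos
  have hdet : (!![0, ζ; ζ, 0] : Matrix (Fin 2) (Fin 2) K).det = 1 := by
    rw [Matrix.det_fin_two_of]
    linear_combination -hζ
  refine ⟨⟨!![0, ζ; ζ, 0], hdet⟩, ?_⟩
  change -(X 0 * X 1) = linSubst (Fin 2) K !![0, ζ; ζ, 0] (X 0 * X 1)
  have e00 : (!![0, ζ; ζ, 0] : Matrix (Fin 2) (Fin 2) K) 0 0 = 0 := rfl
  have e01 : (!![0, ζ; ζ, 0] : Matrix (Fin 2) (Fin 2) K) 0 1 = ζ := rfl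
  have e10 : (!![0, ζ; ζ, 0] : Matrix (Fin 2) (Fin 2) K) 1 0 = ζ := rfl
  have e11 : (!![0, ζ; ζ, 0] : Matrix (Fin 2) (Fin 2) K) 1 1 = 0 := rfl
  rw [linSubst_X_mul_X, e00, e01, e10, e11]
  simp only [zero_mul, mul_zero, zero_add, add_zero, map_zero]
  rw [← pow_two, hζ, X_mul_X_eq_monomial, ← map_neg]

/-- **`xy` is polystable over every algebraically closed field** (its `SL₂`-orbit is closed), by
the one-parameter-subgroup criterion `isPolystable_iff_forall_diagLimit_mem_slOrbit`: for `g ∈ SL₂`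
and weights `(s, -s)`, admissibility of `g·(xy) = αx² + βxy + γy²` kills `γ` (or `α`), and then
`det g = 1` forces `β = ±1`, so the limit `βxy` lies in the orbit (`-xy = g_ζ·xy`). (Kempf's
irreducibility criterion does NOT apply here: `Stab_SL₂(xy)` is a torus.)
[cite: BurgisserIkenmeyer2017, Cor. 2.9 (the form `X₁⋯X_m`)] [cite: Kempf1978, Thm. 1.4] -/
theorem isPolystable_X_mul_X [IsAlgClosed K] :
    IsPolystable (X 0 * X 1 : MvPolynomial (Fin 2) K) := by
  classical
  have hv : (X 0 * X 1 : MvPolynomial (Fin 2) K).IsHomogeneous 2 :=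
    (isHomogeneous_X K 0).mul (isHomogeneous_X K 1)
  refine (isPolystable_iff_forall_diagLimit_mem_slOrbit hv).mpr fun h a ha hadm => ?_
  set g : Matrix (Fin 2) (Fin 2) K := (h : Matrix (Fin 2) (Fin 2) K) with hg
  have hdet : g 0 0 * g 1 1 - g 0 1 * g 1 0 = 1 := by rw [← Matrix.det_fin_two, hg, h.det_coe]
  rw [Fin.sum_univ_two] at ha
  have ha1 : a 1 = -a 0 := by linarith
  -- weights of the three monomials
  have hw0 : diagWeight a (Finsupp.single 0 2) = 2 * a 0 := by
    rw [diagWeight_apply, Fin.sum_univ_two]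
    simp
    ring
  have hwm : diagWeight a (Finsupp.single 0 1 + Finsupp.single 1 1) = 0 := by
    rw [diagWeight_apply, Fin.sum_univ_two]
    simp [ha1]
  have hw1 : diagWeight a (Finsupp.single 1 2) = -(2 * a 0) := by
    rw [diagWeight_apply, Fin.sum_univ_two]
    simp [ha1]
    ring
  -- the extreme coefficients of `g·(xy)`
  have hne02 : (Finsupp.single (0 : Fin 2) 2 : Fin 2 →₀ ℕ) ≠ Finsupp.single 0 1 + Finsupp.single 1 1 :=
    fun h' => by simpa [Finsupp.single_apply] using DFunLike.congr_fun h' 1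
  have hne01 : (Finsupp.single (0 : Fin 2) 2 : Fin 2 →₀ ℕ) ≠ Finsupp.single 1 2 :=
    fun h' => by simpa [Finsupp.single_apply] using DFunLike.congr_fun h' 1
  have hne12 : (Finsupp.single (0 : Fin 2) 1 + Finsupp.single 1 1 : Fin 2 →₀ ℕ) ≠ Finsupp.single 1 2 :=
    fun h' => by simpa [Finsupp.single_apply] using DFunLike.congr_fun h' 0
  have hcoeff0 : coeff (Finsupp.single 0 2) (linSubst (Fin 2) K g (X 0 * X 1)) = g 0 0 * g 0 1 := by
    rw [linSubst_X_mul_X, coeff_add, coeff_add, coeff_monomial, coeff_monomial, coeff_monomial,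
      if_pos rfl, if_neg hne02.symm, if_neg hne01.symm, add_zero, add_zero]
  have hcoeff1 : coeff (Finsupp.single 1 2) (linSubst (Fin 2) K g (X 0 * X 1)) = g 1 0 * g 1 1 := by
    rw [linSubst_X_mul_X, coeff_add, coeff_add, coeff_monomial, coeff_monomial, coeff_monomial,
      if_neg hne01, if_neg hne12, if_pos rfl, zero_add, zero_add]
  rcases lt_trichotomy (a 0) 0 with hneg | hzero | hpos
  · -- `s < 0`: the `x²` coefficient vanishes
    have hα : g 0 0 * g 0 1 = 0 := by
      by_contra hne
      have := hadm _ (mem_support_iff.mpr (hcoeff0.symm ▸ hne))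
      rw [hw0] at this
      linarith
    have hlim : diagLimit a (linSubst (Fin 2) K g (X 0 * X 1)) =
        monomial (Finsupp.single 0 1 + Finsupp.single 1 1) (g 0 0 * g 1 1 + g 1 0 * g 0 1) := by
      rw [linSubst_X_mul_X, hα, map_zero, zero_add, diagLimit_add', diagLimit_monomial',
        diagLimit_monomial', hwm, if_pos rfl, hw1, if_neg (by omega), add_zero]
    rw [hlim]
    rcases mul_eq_zero.mp hα with h00 | h01
    · -- `g 0 0 = 0`: `β = -1`
      have hβ : g 0 0 * g 1 1 + g 1 0 * g 0 1 = -1 := by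
        rw [h00] at hdet ⊢; linear_combination -hdet
      rw [hβ, map_neg, ← X_mul_X_eq_monomial]
      exact neg_X_mul_X_mem_slOrbit
    · -- `g 0 1 = 0`: `β = 1`
      have hβ : g 0 0 * g 1 1 + g 1 0 * g 0 1 = 1 := by
        rw [h01] at hdet ⊢; linear_combination hdet
      rw [hβ, ← X_mul_X_eq_monomial]
      exact mem_slOrbit_self _
  · -- `s = 0`: the limit is `g·(xy)` itself
    have ha0 : a = 0 := by
      funext i
      fin_cases i
      · exact hzero
      · simp [ha1, hzero]
    rw [ha0, diagLimit_zero]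
    exact ⟨h, by rw [hg]⟩
  · -- `s > 0`: the `y²` coefficient vanishes
    have hγ : g 1 0 * g 1 1 = 0 := by
      by_contra hne
      have := hadm _ (mem_support_iff.mpr (hcoeff1.symm ▸ hne))
      rw [hw1] at this
      linarith
    have hlim : diagLimit a (linSubst (Fin 2) K g (X 0 * X 1)) =
        monomial (Finsupp.single 0 1 + Finsupp.single 1 1) (g 0 0 * g 1 1 + g 1 0 * g 0 1) := by
      rw [linSubst_X_mul_X, hγ, map_zero, add_zero, diagLimit_add', diagLimit_monomial',
        diagLimit_monomial', hw0, if_neg (by omega), hwm, if_pos rfl, zero_add]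
    rw [hlim]
    rcases mul_eq_zero.mp hγ with h10 | h11
    · have hβ : g 0 0 * g 1 1 + g 1 0 * g 0 1 = 1 := by
        rw [h10] at hdet ⊢; linear_combination hdet
      rw [hβ, ← X_mul_X_eq_monomial]
      exact mem_slOrbit_self _
    · have hβ : g 0 0 * g 1 1 + g 1 0 * g 0 1 = -1 := by
        rw [h11] at hdet ⊢; linear_combination -hdet
      rw [hβ, map_neg, ← X_mul_X_eq_monomial]
      exact neg_X_mul_X_mem_slOrbit

end Two

/-! ### §3. The Chow form is polystable for every number of variables; `E(X)` for `m = 1` -/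

section All

variable {ι : Type} [Fintype ι] [DecidableEq ι]

/-- **The Chow form `∏ xᵢ` has a closed `SL`-orbit over every algebraically closed field, for
every finite index type** (Bürgisser–Ikenmeyer 2017, Cor. 2.9, the form `X₁⋯X_m`, there over `ℂ`;
here in every characteristic): `|ι| ≤ 1` vacuous, `|ι| = 2` by the one-parameter-subgroup
criterion, `|ι| ≥ 3` by Kempf's criterion. [cite: BurgisserIkenmeyer2017, Cor. 2.9 (the form `X₁⋯X_m`)] -/
theorem isPolystable_prod_X_of_isAlgClosed [IsAlgClosed K] :
    IsPolystable (∏ i : ι, X i : MvPolynomial ι K) := by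
  rcases Nat.lt_or_ge (Fintype.card ι) 3 with hlt | hge
  · rcases Nat.lt_or_ge (Fintype.card ι) 2 with hlt2 | hge2
    · exact isPolystable_prod_X_of_card_le_one (by omega)
    · have h2 : Fintype.card ι = 2 := by omega
      let e : Fin 2 ≃ ι := (Fintype.equivFinOfCardEq h2).symm
      have hprod : (∏ i : ι, X i : MvPolynomial ι K) = rename e (X 0 * X 1) := by
        rw [map_mul, rename_X, rename_X, ← Fin.prod_univ_two (fun j => (X (e j) : MvPolynomial ι K))]
        exact (Fintype.prod_equiv e (fun j => X (e j)) (fun i => X i) (fun j => rfl)).symm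
      rw [hprod]
      exact IsPolystable.rename_equiv e isPolystable_X_mul_X
  · exact isPolystable_prod_X_of_three_le hge

end All

/-- **`E(X)` for one row is the Chow form**: `msE K 1 k = ∏ x_p` over all `p : Fin 1 × (Fin 1 × Fin k)`
(each `det_σ` is the `1 × 1` determinant `x_{(0,(0,σ 0))}`). [cite: MulmuleySohoniSIAM2001, §7 (definition of `E(X)`, AV p.30)] -/
theorem msE_one_eq_prod_X (kk : ℕ) :
    msE K 1 kk = ∏ p : Fin 1 × (Fin 1 × Fin kk), X p := by
  rw [msE]
  simp_rw [Matrix.det_fin_one, Matrix.of_apply]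
  refine Fintype.prod_bijective (fun σ : Fin 1 → Fin kk => ((0 : Fin 1), ((0 : Fin 1), σ 0)))
    ⟨?_, ?_⟩ _ _ (fun σ => rfl)
  · intro σ σ' h
    funext i
    rw [Subsingleton.elim i 0]
    simpa using h
  · rintro ⟨r, i, j⟩
    refine ⟨fun _ => j, ?_⟩
    rw [Subsingleton.elim r 0, Subsingleton.elim i 0]

/-- **GCT I Thm. 7.3, the case `m = 1`, over every algebraically closed field and for every `k`**
(no characteristic proviso needed in this corner): `E(X) = x₁⋯x_k` has a closed `SL_k`-orbit.
Input brick for the `∀F` closer of `MS2001_thm_7_3` (owner t02 g8; `m ≥ 2` by the stabiliser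
irreducibility, p5 g6). [cite: MulmuleySohoniSIAM2001, Thm. 7.3 of the authors' version = journal Thm. 7.1 (AV p.31)] [cite: BurgisserIkenmeyer2017, Cor. 2.9 (the form `X₁⋯X_m`)] -/
theorem isPolystable_msE_one [IsAlgClosed K] (kk : ℕ) : IsPolystable (msE K 1 kk) := by
  rw [msE_one_eq_prod_X]
  exact isPolystable_prod_X_of_isAlgClosed

end Literature.Computability.AlgebraicComplexity
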